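import Summits.ResolutionOfSingularities.KangarooAtlas.MizutaniPIndependent
import Summits.ResolutionOfSingularities.KangarooAtlas.MizutaniTheoremF
import Mathlib.FieldTheory.IntermediateField.Adjoin.Algebra
import HarnessLib

/-!
# Mizutani's conjecture `m(e) = 2p^e − 1` — the finite tower `k^{p^e}(b)` of a `p`-independent family

Cell topic `Summits/ResolutionOfSingularities/KangarooAtlas` (pub-rosobs); namespace
`Summit.ResolutionOfSingularities.KangarooAtlas.Mizutani`.  Part of the Lean transcription of the
in-house note MIZUTANI-PROOF-g59 (AI-written, AI-audited; *AI review is weaker than expert review*; not a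
resolution theorem).  §3 DICTIONARY, step (F′): for a finite `p`-independent family `b` of `k`
(`MizutaniPIndependent`) and `K = k^{p^e}`, the intermediate field `F = K(b)` is a TOWER in the sense of
encloser-1's `IsRootTower K F (p^e) x a` (`a_i = b_i`, `x_i = b_i^{p^e}`): the presentation
`K[Y]/(Y_i^{p^e} − x_i) → F` is bijective (`isRootTower_adjoin`), and `[F : K] = (p^e)^s` (`finrank_adjoin_eq`);
`F` has characteristic `p` and `K` is infinite when `k` is.  This is the note's tower `k' = 𝕜(x^{1/q})` (§1.1)
realised INSIDE `k` over `k^q`, for the finitely many elements that a given tensor involves.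

References: [Mizutani1973HironakaGroupSchemes] Lemma 2.4 (p. 88), Remark 2.10 (in-house proof §1.1, §3 (c)).
-/

open MvPolynomial Literature.AlgebraicGeometry.Resolution.HironakaScheme

namespace Summit.ResolutionOfSingularities.KangarooAtlas.Mizutani

universe u

section FinTower

variable {k : Type u} [Field k] {p : ℕ} [hp : Fact p.Prime] [CharP k p] (e : ℕ) {s : ℕ} (b : Fin s → k)

/-- The tower field `F = k^{p^e}(b)`. [cite: Mizutani1973HironakaGroupSchemes, Lemma 2.4 (p. 88: K = k^q(c_1, …, c_m))] -/
noncomputable abbrev towerField : IntermediateField (frobPow k p e) k :=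
  IntermediateField.adjoin (frobPow k p e) (Set.range b)

/-- The generators `a_i = b_i ∈ F`. [folklore] -/
noncomputable def towerGen (i : Fin s) : towerField e b :=
  ⟨b i, IntermediateField.subset_adjoin _ _ ⟨i, rfl⟩⟩

/-- The `p^e`-th powers `x_i = b_i^{p^e} ∈ K = k^{p^e}`. [folklore] -/
def towerPow (i : Fin s) : frobPow k p e := ⟨b i ^ p ^ e, pow_mem_frobPow e (b i)⟩

/-- `(a_i : k) = b_i`. [folklore] -/
@[simp] theorem coe_towerGen (i : Fin s) : ((towerGen e b i : towerField e b) : k) = b i := rfl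

/-- The tower relation `a_i^{p^e} = x_i`. [folklore] -/
theorem towerGen_pow (i : Fin s) :
    towerGen e b i ^ p ^ e = algebraMap (frobPow k p e) (towerField e b) (towerPow e b i) :=
  Subtype.ext (by simp [towerPow]; rfl)

/-- The generators are integral over `K` (roots of `Y^{p^e} − x_i`). [folklore] -/
theorem isIntegral_gen (i : Fin s) : IsIntegral (frobPow k p e) (b i) := by
  refine ⟨Polynomial.X ^ p ^ e - Polynomial.C (towerPow e b i),
    Polynomial.monic_X_pow_sub_C _ (pow_ne_zero e hp.out.ne_zero), ?_⟩
  rw [Polynomial.eval₂_sub, Polynomial.eval₂_X_pow, Polynomial.eval₂_C, sub_eq_zero]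
  rfl

/-- Box monomials of the generators, read in `k`. [folklore] -/
theorem coe_aeval_monomial (N : Fin s →₀ ℕ) (c : frobPow k p e) :
    ((aeval (towerGen e b) (monomial N c) : towerField e b) : k) = (c : k) * ∏ i, b i ^ N i := by
  have h := congrArg (fun φ => φ (monomial N c)) (MvPolynomial.comp_aeval (R := frobPow k p e)
    (towerField e b).val (f := towerGen e b))
  simp only [AlgHom.comp_apply] at h
  rw [IntermediateField.coe_val] at h
  rw [show ((aeval (towerGen e b) (monomial N c) : towerField e b) : k) =
    aeval (fun i => ((towerGen e b i : towerField e b) : k)) (monomial N c) from h]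
  rw [MvPolynomial.aeval_monomial, Finsupp.prod_fintype _ _ (fun i => by simp)]
  rfl

/-- **The presentation is onto**: `F = K(b)` is generated by the `a_i` (algebraic elements). [folklore] -/
theorem liftHom_surjective :
    Function.Surjective (liftHom (L := frobPow k p e) (x := towerPow e b) (q := p ^ e) (towerGen e b)
      (towerGen_pow e b)) := by
  intro z
  have hz : (z : k) ∈ (towerField e b).toSubalgebra := z.2
  rw [IntermediateField.adjoin_toSubalgebra_of_isAlgebraic
      (fun y hy => by obtain ⟨i, rfl⟩ := hy; exact (isIntegral_gen e b i).isAlgebraic),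
    Algebra.adjoin_range_eq_range_aeval] at hz
  obtain ⟨P, hP⟩ := hz
  refine ⟨Ideal.Quotient.mk _ P, Subtype.ext ?_⟩
  rw [liftHom_mk]
  have h := congrArg (fun φ => φ P) (MvPolynomial.comp_aeval (R := frobPow k p e)
    (towerField e b).val (f := towerGen e b))
  simp only [AlgHom.comp_apply] at h
  rw [IntermediateField.coe_val] at h
  rw [h, ← hP]
  rfl

/-- Every class of the presentation `K[Y]/(Y^q − x)` is a `K`-combination of box monomials. [folklore] -/
theorem mk_mem_span_box (P : MvPolynomial (Fin s) (frobPow k p e)) :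
    Ideal.Quotient.mk (rootIdeal (frobPow k p e) (towerPow e b) (p ^ e)) P ∈
      Submodule.span (frobPow k p e) (Set.range fun W : Fin s → Fin (p ^ e) =>
        Ideal.Quotient.mk (rootIdeal (frobPow k p e) (towerPow e b) (p ^ e)) (monomial (Box.toF W) 1)) := by
  classical
  have hq : 0 < p ^ e := pow_pos hp.out.pos e
  set R := RootTower (frobPow k p e) (towerPow e b) (p ^ e) with hR
  set mk := Ideal.Quotient.mk (rootIdeal (frobPow k p e) (towerPow e b) (p ^ e)) with hmk
  induction P using MvPolynomial.induction_on' with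
  | monomial N c =>
    -- `[X^N] = (∏ x_i^{N_i / q}) • [X^{N mod q}]`
    set W : Fin s → Fin (p ^ e) := fun i => ⟨N i % p ^ e, Nat.mod_lt _ hq⟩ with hW
    have hgen : ∀ i, mk (X i) ^ p ^ e = algebraMap (frobPow k p e) R (towerPow e b i) :=
      fun i => rootGen_pow (frobPow k p e) (towerPow e b) (p ^ e) i
    have hXN : mk (monomial N (1 : frobPow k p e)) =
        algebraMap (frobPow k p e) R (∏ i, towerPow e b i ^ (N i / p ^ e)) * mk (monomial (Box.toF W) 1) := by
      rw [monomial_eq, MvPolynomial.C_1, one_mul, monomial_eq, MvPolynomial.C_1, one_mul,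
        Finsupp.prod_fintype _ _ (fun i => by simp),
        Finsupp.prod_fintype _ _ (fun i => by simp), map_prod, map_prod, map_prod, ← Finset.prod_mul_distrib]
      refine Finset.prod_congr rfl fun i _ => ?_
      rw [map_pow, map_pow, map_pow, Box.toF_apply]
      conv_lhs => rw [← Nat.div_add_mod (N i) (p ^ e)]
      rw [pow_add, pow_mul, hgen i]
    have hmono : monomial N c = MvPolynomial.C c * monomial N 1 := by rw [MvPolynomial.C_mul_monomial, mul_one]
    have hC : mk (MvPolynomial.C c) = algebraMap (frobPow k p e) R c := rfl
    rw [hmono, map_mul, hXN, hC, ← mul_assoc, ← map_mul]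
    have key := (Algebra.smul_def (R := frobPow k p e) (A := R) (c * ∏ i, towerPow e b i ^ (N i / p ^ e))
      (mk (monomial (Box.toF W) 1))).symm
    rw [key]
    exact Submodule.smul_mem _ _ (Submodule.subset_span ⟨W, rfl⟩)
  | add P Q hP hQ => rw [map_add]; exact Submodule.add_mem _ hP hQ

variable {e b}

/-- **The presentation is injective** when the box monomials of `b` are `k^{p^e}`-independent. [folklore] -/
theorem liftHom_injective (hb : PIndep p e b) :
    Function.Injective (liftHom (L := frobPow k p e) (x := towerPow e b) (q := p ^ e) (towerGen e b)
      (towerGen_pow e b)) := by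
  classical
  -- short-circuit the (slow) scalar-action instance search on the presentation
  letI : SMul (frobPow k p e) (RootTower (frobPow k p e) (towerPow e b) (p ^ e)) := Algebra.toSMul
  rw [injective_iff_map_eq_zero]
  intro z hz
  obtain ⟨P, rfl⟩ := Ideal.Quotient.mk_surjective z
  obtain ⟨c, hc⟩ := Submodule.mem_span_range_iff_exists_fun (R := frobPow k p e).mp (mk_mem_span_box e b P)
  rw [← hc] at hz ⊢
  -- read the relation in `k`
  have hrel : ∑ W : Fin s → Fin (p ^ e), c W • fmon b W = 0 := by
    have h1 := congrArg (towerField e b).val hz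
    simp only [map_sum, map_zero] at h1
    have hterm : ∀ W : Fin s → Fin (p ^ e), (towerField e b).val (liftHom (towerGen e b) (towerGen_pow e b)
        (c W • Ideal.Quotient.mk (rootIdeal (frobPow k p e) (towerPow e b) (p ^ e)) (monomial (Box.toF W) 1))) =
        c W • fmon b W := by
      intro W
      rw [map_smul, map_smul, liftHom_mk, IntermediateField.coe_val, coe_aeval_monomial]
      simp only [OneMemClass.coe_one, one_mul, Box.toF_apply, Subfield.smul_def, smul_eq_mul]
      rfl
    simpa only [hterm] using h1
  have hc0 := Fintype.linearIndependent_iff.mp hb c hrel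
  simp [hc0]

/-- **`K(b)` is a tower**: `IsRootTower (k^{p^e}) (k^{p^e}(b)) (p^e) (b^{p^e}) b` for a family `b` whose box
monomials of level `p^e` are `k^{p^e}`-independent (MIZUTANI-PROOF-g59 §1.1 (F), realised inside `k`).
[cite: Mizutani1973HironakaGroupSchemes, Remark 2.10 (in-house proof §1.1 example (F): k' = 𝕜(x^{1/q}))] -/
theorem isRootTower_adjoin (hb : PIndep p e b) :
    IsRootTower (frobPow k p e) (towerField e b) (p ^ e) (towerPow e b) (towerGen e b) :=
  ⟨towerGen_pow e b, liftHom_injective hb, liftHom_surjective e b⟩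

/-- The box monomials `a^W` form a `K`-basis of `F = K(b)`; hence `[F : K] = (p^e)^s`.
[cite: Mizutani1973HironakaGroupSchemes, Remark 2.10 (in-house proof §1.1: the monomials a^W form an L-basis)] -/
theorem finrank_adjoin_eq (hb : PIndep p e b) :
    Module.finrank (frobPow k p e) (towerField e b) = (p ^ e) ^ s := by
  classical
  letI : SMul (frobPow k p e) (RootTower (frobPow k p e) (towerPow e b) (p ^ e)) := Algebra.toSMul
  -- the family `W ↦ a^W` in `F`
  set v : (Fin s → Fin (p ^ e)) → towerField e b :=
    fun W => ⟨fmon b W, fmon_mem b (towerField e b) (fun i => IntermediateField.subset_adjoin _ _ ⟨i, rfl⟩) W⟩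
    with hv
  have hli : LinearIndependent (frobPow k p e) v := by
    refine LinearIndependent.of_comp (towerField e b).val.toLinearMap ?_
    exact hb
  have hsp : ⊤ ≤ Submodule.span (frobPow k p e) (Set.range v) := by
    intro z _
    obtain ⟨w, rfl⟩ := liftHom_surjective e b z
    obtain ⟨P, rfl⟩ := Ideal.Quotient.mk_surjective w
    obtain ⟨c, hc⟩ := Submodule.mem_span_range_iff_exists_fun (R := frobPow k p e).mp (mk_mem_span_box e b P)
    rw [← hc, map_sum]
    refine Submodule.sum_mem _ fun W _ => ?_
    rw [map_smul]
    refine Submodule.smul_mem _ _ ?_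
    have : liftHom (towerGen e b) (towerGen_pow e b)
        (Ideal.Quotient.mk (rootIdeal (frobPow k p e) (towerPow e b) (p ^ e)) (monomial (Box.toF W) 1)) = v W := by
      apply Subtype.ext
      rw [liftHom_mk, coe_aeval_monomial]
      simp only [OneMemClass.coe_one, one_mul, Box.toF_apply, hv]
      rfl
    rw [this]
    exact Submodule.subset_span ⟨W, rfl⟩
  rw [Module.finrank_eq_card_basis (Module.Basis.mk hli hsp), Fintype.card_fun, Fintype.card_fin, Fintype.card_fin]

/-- `F = K(b)` has characteristic `p`. [folklore] -/
instance charP_towerField : CharP (towerField e b) p :=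
  (algebraMap (towerField e b) k).charP Subtype.val_injective p

/-- `k^{p^e}` is infinite when `k` is. [folklore] -/
theorem infinite_frobPow [Infinite k] : Infinite (frobPow k p e) :=
  Infinite.of_injective (fun y : k => (⟨y ^ p ^ e, pow_mem_frobPow e y⟩ : frobPow k p e))
    fun _ _ h => pow_char_pow_injective e (congrArg Subtype.val h :)

end FinTower

end Summit.ResolutionOfSingularities.KangarooAtlas.Mizutani
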